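import Literature.AnabelianGeometry.SemiGraphs.TemperedSpecialFibreReductionsSchemaS3
import Literature.AnabelianGeometry.SemiGraphs.TemperedCuspOmissionHypotheses
import HarnessLib

/-!
# [SemiAnbd] Cor. 3.11, step (S3)/(S3′) as typed: EVERY semi-graph of anabelioids with a cusp yields a
# counter-model at an all-certifying origin (the cusp-omission pair, in general)

Mochizuki, *Semi-graphs of anabelioids*, Publ. RIMS **42** (2006), §3, Corollary 3.11 and its proof,
manuscript pp. 45–49 [cite: MochizukiSemiAnbd2006, Cor 3.11 pp.45-49]; §1 p. 13 (maximal subgraph);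
Mochizuki, *Inter-universal Teichmüller theory I*, §2 p. 44 ("the omission of cuspidal edges clearly does not
affect … the tempered … fundamental groups") [cite: Mochizuki2012, §2 p.44].

PROOF-ONLY sequel (no `def`, no `instance`) of `TemperedSpecialFibreReductionsSchemaS3.lean` (abc-iut-f-177:
FACT-LIST F-1727 `SpecialFibreIsoOfChartIso` and its γ-descended twin F-3254 `SpecialFibreIsoOfDescendedIso` have
false universal closure over the origin parameter, witnessed by ONE cusp graph) and of
`TemperedCuspOmissionHypotheses.lean` (the Thm-3.7 hypotheses pass to a cusp omission).  Here the mechanism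
is stated in GENERAL: for EVERY semi-graph of anabelioids `𝒢` satisfying the hypotheses of Thm. 3.7 that has
an OPEN edge (a cusp) — e.g. the special fibre `G^c` of the stable model of ANY pointed stable curve with
`r ≥ 1` marked points — one tempered arithmetic group over `ℚ_p` carries the two special-fibre data `(𝒢, Π)`
and `(𝒢|_{𝔾_max}, Π)` (all open edges omitted; the SAME tempered group `Π = π₁^temp`, by transport along the
cusp-omission equivalence) with the same admissible quotient, and NO isomorphism of semi-graphs of anabelioids
`𝒢 ⥲ 𝒢|_{𝔾_max}` (an isomorphism maps a branch abutting to no vertex to such a branch, but the maximal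
subgraph is a graph):

* `SemiGraph.exists_abuts_eq_none_of_isOpenEdge`, `ProfiniteSemiGraph.not_isIso_hom_restrict_maximalSubgraph`;
* `exists_cuspOmission_specialFibrePair_of_isOpenEdge` — the pair over one `D`, for any such `𝒢`;
* `not_specialFibreIsoOfChartIso_of_allCertifying_of_isOpenEdge`,
  `not_specialFibreIsoOfDescendedIso_of_allCertifying_of_isOpenEdge` — so (S3)/(S3′) fail at every origin pair
  certifying BOTH data; in particular at the all-certifying origins (recovering the F-1727 / F-3254 verdicts
  from ANY cusp-bearing witness, e.g. `IwahoriWitness.cuspGraph 2` with `cuspSemiGraph_isOpenEdge` — the tree's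
  `not_forall_specialFibreIsoOfChartIso` is the special case, not restated here).

HONEST LIMIT: a GENUINE origin certifies the special fibre `G^c` of a curve but NOT its cusp-omitted twin
(which is not the special fibre of that curve), so nothing here refutes (S3)/(S3′) at genuine origins; the
typed rows stay «schema; consumable BY NAME at a named origin pair» (`corollary_3_11_of_steps(')`).  A remark
about OUR typing; nothing of [SemiAnbd] is refuted; nothing here bears on [IUTchIII] Cor. 3.12.
-/

noncomputable section

namespace Literature.AnabelianGeometry.SemiGraphs

open ProfiniteSemiGraph Topology CategoryTheory

/-! ### An open edge has a branch abutting to no vertex; no isomorphism onto the maximal subgraph -/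

/-- An open edge (verticial cardinality `< 2`) has a branch that abuts to no vertex.
[cite: MochizukiSemiAnbd2006, §1 p.12] -/
theorem SemiGraph.exists_abuts_eq_none_of_isOpenEdge {G : SemiGraph} {e : G.Edge} (he : G.IsOpenEdge e) :
    ∃ b : G.Branch, G.edgeOf b = e ∧ G.abuts b = none := by
  by_contra hne
  push Not at hne
  obtain ⟨b₁, b₂, h12, h₁, h₂, hall⟩ := G.two_branches e
  have hs₁ : (G.abuts b₁).isSome = true := Option.ne_none_iff_isSome.mp (hne b₁ h₁)
  have hs₂ : (G.abuts b₂).isSome = true := Option.ne_none_iff_isSome.mp (hne b₂ h₂)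
  have hsub : ({b₁, b₂} : Set G.Branch) ⊆ G.verticialPortion e := by
    intro b hb
    simp only [Set.mem_insert_iff, Set.mem_singleton_iff] at hb
    rcases hb with rfl | rfl
    exacts [⟨h₁, hs₁⟩, ⟨h₂, hs₂⟩]
  have hfin : (G.verticialPortion e).Finite :=
    Set.Finite.subset (Set.toFinite ({b₁, b₂} : Set G.Branch)) fun b hb => by
      simp only [Set.mem_insert_iff, Set.mem_singleton_iff]
      exact hall b hb.1
  have h2 : 2 ≤ G.vertCard e :=
    calc 2 = ({b₁, b₂} : Set G.Branch).ncard := (Set.ncard_pair h12).symm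
      _ ≤ (G.verticialPortion e).ncard := Set.ncard_le_ncard hsub hfin
      _ = G.vertCard e := rfl
  exact absurd he (not_lt.mpr h2)

/-- **No isomorphism of semi-graphs of anabelioids from a semi-graph with an open edge onto its maximal
subgraph**: an isomorphism maps a branch abutting to no vertex to such a branch, but every branch of the
maximal subgraph abuts (it is a graph, `SemiGraph.isGraph_maximalSubgraph`).
[cite: MochizukiSemiAnbd2006, §1 p.13] -/
theorem ProfiniteSemiGraph.not_isIso_hom_restrict_maximalSubgraph (𝒢 : ProfiniteSemiGraph)
    {e : 𝒢.graph.Edge} (he : 𝒢.graph.IsOpenEdge e)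
    (F : Hom 𝒢 (𝒢.restrict 𝒢.graph.maximalSubgraph)) : ¬ F.IsIso := by
  intro hF
  obtain ⟨b, -, hb⟩ := SemiGraph.exists_abuts_eq_none_of_isOpenEdge he
  have h1 := hF.abuts_none b hb
  have h2 := (SemiGraph.isGraph_maximalSubgraph 𝒢.graph).abuts_isSome (F.base.branchMap b)
  change ((𝒢.restrict 𝒢.graph.maximalSubgraph).graph.abuts (F.base.branchMap b)).isSome = true at h2
  rw [h1] at h2
  exact Bool.false_ne_true h2

/-! ### The cusp-omission pair over one tempered arithmetic group, for ANY cusp-bearing `𝒢` -/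

/-- **The cusp-omission pair, in general.**  For every semi-graph of anabelioids `𝒢` satisfying the
hypotheses of Thm. 3.7 with an open edge and every prime `p`: one tempered arithmetic group `D` over `ℚ_p`
carrying the special-fibre data `(𝒢, Π)` and `(𝒢|_{𝔾_max}, Π)` with the SAME tempered group `Π` (Prop. 3.6
(i)(ii) for the maximal subgraph — hypotheses by `Thm37Hypotheses.restrict_of_isCuspOmission` — transported
along the cusp-omission equivalence) and the same admissible quotient, so that `φ := id` is descended from
`γ := id`; and no isomorphism `𝒢 ⥲ 𝒢|_{𝔾_max}`.  Model `D`: `TemperedArithmeticGroup.exists_padic_specialFibreModel`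
(abc-iut-f-106). [cite: Mochizuki2012, §2 p.44] -/
theorem exists_cuspOmission_specialFibrePair_of_isOpenEdge (p : ℕ) [Fact p.Prime]
    (𝒢 : ProfiniteSemiGraph.{0}) (h37 : 𝒢.Thm37Hypotheses) {e₀ : 𝒢.graph.Edge}
    (he₀ : 𝒢.graph.IsOpenEdge e₀) :
    ∃ (D : TemperedArithmeticGroup ℚ_[p]) (Sα Sβ : SpecialFibreData D) (φ : Sα.chart.G ≃ₜ* Sβ.chart.G),
      Sα.Gc = 𝒢 ∧ (∀ x : D.delta, φ (Sα.admissible x) = Sβ.admissible x) ∧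
        ∀ F : Hom Sα.Gc Sβ.Gc, ¬ F.IsIso := by
  have hH := h37.toProp36Hypotheses.maximalSubgraph_isCuspOmission
  have h37' := h37.restrict_of_isCuspOmission hH
  obtain ⟨eqv⟩ := nonempty_btempCat_equivalence hH
  let c₂ : TemperedPiChart (𝒢.restrict 𝒢.graph.maximalSubgraph) :=
    (𝒢.restrict 𝒢.graph.maximalSubgraph).temperedPiChart h37'.toProp36Hypotheses
  let c₁ : TemperedPiChart 𝒢 := c₂.transport eqv
  obtain ⟨D, -, -, ⟨ι⟩⟩ := TemperedArithmeticGroup.exists_padic_specialFibreModel p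
    (𝒢.restrict 𝒢.graph.maximalSubgraph) h37' c₂
  let adm : D.delta →ₜ* c₂.G := ⟨ι.toMulEquiv.toMonoidHom, by exact map_continuous ι⟩
  have hadm : Function.Surjective adm := fun g => ⟨ι.symm g, ι.apply_symm_apply g⟩
  let Sα : SpecialFibreData D :=
    { Gc := 𝒢, hyp := h37, chart := c₁, admissible := adm, admissible_surjective := hadm }
  let Sβ : SpecialFibreData D :=
    { Gc := 𝒢.restrict 𝒢.graph.maximalSubgraph, hyp := h37', chart := c₂, admissible := adm,
      admissible_surjective := hadm }
  exact ⟨D, Sα, Sβ, ContinuousMulEquiv.refl _, rfl, fun _ => rfl,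
    fun F => ProfiniteSemiGraph.not_isIso_hom_restrict_maximalSubgraph 𝒢 he₀ F⟩

/-! ### (S3) and (S3′) fail at every all-certifying origin — from ANY cusp-bearing Thm-3.7 semi-graph -/

/-- **(S3) fails at the all-certifying origins over `ℚ_p`, witnessed by ANY semi-graph of anabelioids with a
cusp satisfying the hypotheses of Thm. 3.7** (generalising `not_specialFibreIsoOfChartIso_of_allCertifying`,
which used `IwahoriWitness.cuspGraph p`). [cite: MochizukiSemiAnbd2006, Cor 3.11 pp.46-48] -/
theorem not_specialFibreIsoOfChartIso_of_allCertifying_of_isOpenEdge (p : ℕ) [Fact p.Prime]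
    (Ωα Ωβ : SpecialFibreOrigin ℚ_[p])
    (hα : ∀ D S, Ωα.IsSpecialFibreOf D S) (hβ : ∀ D S, Ωβ.IsSpecialFibreOf D S)
    (𝒢 : ProfiniteSemiGraph.{0}) (h37 : 𝒢.Thm37Hypotheses) {e₀ : 𝒢.graph.Edge}
    (he₀ : 𝒢.graph.IsOpenEdge e₀) : ¬ SpecialFibreIsoOfChartIso Ωα Ωβ := by
  intro h
  obtain ⟨D, Sα, Sβ, φ, -, -, hno⟩ := exists_cuspOmission_specialFibrePair_of_isOpenEdge p 𝒢 h37 he₀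
  obtain ⟨F, hF, -⟩ := h D D Sα Sβ (hα _ _) (hβ _ _) φ
  exact hno F hF

/-- **(S3′) fails at the all-certifying origins over `ℚ_p`, witnessed by ANY semi-graph of anabelioids with a
cusp satisfying the hypotheses of Thm. 3.7** (`γ := id`, the descended `φ := id`).
[cite: MochizukiSemiAnbd2006, Cor 3.11 p.48] -/
theorem not_specialFibreIsoOfDescendedIso_of_allCertifying_of_isOpenEdge (p : ℕ) [Fact p.Prime]
    (Ωα Ωβ : SpecialFibreOrigin ℚ_[p])
    (hα : ∀ D S, Ωα.IsSpecialFibreOf D S) (hβ : ∀ D S, Ωβ.IsSpecialFibreOf D S)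
    (𝒢 : ProfiniteSemiGraph.{0}) (h37 : 𝒢.Thm37Hypotheses) {e₀ : 𝒢.graph.Edge}
    (he₀ : 𝒢.graph.IsOpenEdge e₀) : ¬ SpecialFibreIsoOfDescendedIso Ωα Ωβ := by
  intro h
  obtain ⟨D, Sα, Sβ, φ, -, hφ, hno⟩ := exists_cuspOmission_specialFibrePair_of_isOpenEdge p 𝒢 h37 he₀
  obtain ⟨F, hF, -⟩ := h D D Sα Sβ (hα _ _) (hβ _ _) (ContinuousMulEquiv.refl _) φ (fun x => hφ x)
  exact hno F hF

/-- More sharply: (S3) fails at every origin pair that certifies BOTH members of a cusp-omission pair — a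
remark on exactly which certificates are incompatible with the typed (S3) (a genuine origin certifies `G^c`
but not its cusp-omitted twin). [cite: MochizukiSemiAnbd2006, Cor 3.11 pp.46-48] -/
theorem not_specialFibreIsoOfChartIso_of_certifies_cuspOmissionPair (p : ℕ) [Fact p.Prime]
    (Ωα Ωβ : SpecialFibreOrigin ℚ_[p]) (𝒢 : ProfiniteSemiGraph.{0}) (h37 : 𝒢.Thm37Hypotheses)
    {e₀ : 𝒢.graph.Edge} (he₀ : 𝒢.graph.IsOpenEdge e₀)
    (hα : ∀ (D : TemperedArithmeticGroup ℚ_[p]) (S : SpecialFibreData D), S.Gc = 𝒢 → Ωα.IsSpecialFibreOf D S)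
    (hβ : ∀ (D : TemperedArithmeticGroup ℚ_[p]) (S : SpecialFibreData D),
      S.Gc = 𝒢.restrict 𝒢.graph.maximalSubgraph → Ωβ.IsSpecialFibreOf D S) :
    ¬ SpecialFibreIsoOfChartIso Ωα Ωβ := by
  intro h
  have hH := h37.toProp36Hypotheses.maximalSubgraph_isCuspOmission
  have h37' := h37.restrict_of_isCuspOmission hH
  obtain ⟨eqv⟩ := nonempty_btempCat_equivalence hH
  let c₂ : TemperedPiChart (𝒢.restrict 𝒢.graph.maximalSubgraph) :=
    (𝒢.restrict 𝒢.graph.maximalSubgraph).temperedPiChart h37'.toProp36Hypotheses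
  let c₁ : TemperedPiChart 𝒢 := c₂.transport eqv
  obtain ⟨D, -, -, ⟨ι⟩⟩ := TemperedArithmeticGroup.exists_padic_specialFibreModel p
    (𝒢.restrict 𝒢.graph.maximalSubgraph) h37' c₂
  let adm : D.delta →ₜ* c₂.G := ⟨ι.toMulEquiv.toMonoidHom, by exact map_continuous ι⟩
  have hadm : Function.Surjective adm := fun g => ⟨ι.symm g, ι.apply_symm_apply g⟩
  let Sα : SpecialFibreData D :=
    { Gc := 𝒢, hyp := h37, chart := c₁, admissible := adm, admissible_surjective := hadm }
  let Sβ : SpecialFibreData D :=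
    { Gc := 𝒢.restrict 𝒢.graph.maximalSubgraph, hyp := h37', chart := c₂, admissible := adm,
      admissible_surjective := hadm }
  obtain ⟨F, hF, -⟩ := h D D Sα Sβ (hα D Sα rfl) (hβ D Sβ rfl) (ContinuousMulEquiv.refl _)
  exact ProfiniteSemiGraph.not_isIso_hom_restrict_maximalSubgraph 𝒢 he₀ F hF

end Literature.AnabelianGeometry.SemiGraphs

end
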